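import Summits.ABC.IUTFork.Cor312LicenceWildInhabitedRealising
import Summits.ABC.IUTFork.Cor312ProvKChosenQIdeleNorm
import HarnessLib

/-!
# [IUTchIII] Cor. 3.12, branch C / R-W W1 — the hull licence INHABITED at GENUINE `K`-level data with RATIONAL `j`-invariant
# from per-bad-prime integers `(e_p, D_p, h_p, ρin_p, ρout_p)`: the q-degree `P_p = e_p·h_p/(2l)` is read off the pole order `h_p` of `j`

PROOF-ONLY file (D-0012; 0 definitions, 0 `Prop` facts) of the abc-iut cell — D-0079 RESCUE sub-cell R-W, W1 ROW DECISIONS composer seat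
abc-iut-W-row-1 (gen 0); sequel of `Cor312LicenceWildInhabitedRealising` at the GENUINE `K`-level Dupuy–Hilado datum
`X := Cor312Prov.pilotDataOfK D K` of a collection of initial Θ-data `D` ([IUTchI] Def. 3.1) whose curve has a RATIONAL `j`-invariant `j₀`
(the `λ`-line data of [IUTchIV] Cor. 2.2 / the R-W WINDOW-TABLE rows). TAKES NO SIDE on [IUTchIII] Cor. 3.12 or on any author.

WHAT IS PROVED (namespace `Summit.ABC.IUTFork.Cor312Prov`; Θ- and q-ideles REALISING the pilot divisors of `X`).
* `qPilot_pilotDataOfK_eq_of_ord_rat` — at a bad place `x | p` with `e(K_x/ℚ_p) = e_p` and `ord_p(j₀) = −h_p`: `P_q(x) = e_p·h_p/(2l)`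
  (abc-iut-w4-d026's `norm_chosenQIdele_eq_rpow_ord_rat'`: `‖t_q(x)‖ = p^{ord_p(j₀)/(2l)}` for the CHOSEN realising q-idele, against
  abc-iut-w5-d236's `‖t_q(x)‖ = p^{−P_q(x)/e(x|p)}`; the ramification cancels).
* **`licence_settingPrVolSharp_pilotDataOfK_of_orders_rat`** / **`exists_qPinned_and_hull_settingPrVolSharp_pilotDataOfK_of_orders_rat`** —
  for ANY realising ideles: if at every bad fibre point `x | p` the LOCAL TYPE is pinned one-sidedly (`e(K_x/ℚ_p) = e_p`, `d(K_x) ≥ D_p/e_p`,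
  a non-member of `log_p(𝒪^×_{K_x})` of norm `≤ p^{−(ρin_p−1)/e_p}`, a member of norm `≥ p^{−ρout_p/e_p}`), `ord_p(j₀) = −h_p` with
  `2l ∣ e_p·h_p`, the bad completions over `p` are pairwise `ℚ_p`-isomorphic, and the INTEGER CELL
  `e_p·⌊(j²P_p − jD_p − (j+1)ρin_p)/e_p⌋ + (j+1)ρout_p ≤ P_p` (`P_p = e_p·h_p/(2l)`) holds at every label `j ≤ l⋆`, THEN
  abc-iut-c312-1's `Thm311ToCor312.Licence` — and branch C's «∃ ρ qK, QPinned ∧ PilotKummerCompatHull» — hold at `settingPrVolSharp X …`.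
READING (neutral): this is the socket the R-W WINDOW-TABLE's INHABITED rows plug into (HOME/plan/rescue/R-W/OPEN-10.md): its remaining
inputs are the LOCAL TYPE at the bad primes (GAP-LEDGER G-Wnum2-1 at `p ∈ {3,5}`; abc-iut-W-neg-1's lemmas at tame poles) and the conjugacy of
the bad fibre. HONEST SCOPE: OUR sharp containers and Dupuy–Hilado's typed (Ind1)/(Ind2); STRONGER-THAN-PRINT hull reading; nothing about the
printed inequality, the number-level corollary or the existence of initial Θ-data; typed ≠ proved; instantiated ≠ endorsed.
[cite: Mochizuki2012, IUTchI Def. 3.1 (b),(c) pp. 61–62, Ex. 3.2 (iv) p. 71; IUTchIII Cor. 3.12 Step (xi-f) p. 184; IUTchIV Prop. 1.1 p. 9,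
Cor. 2.2 (ii) proof (P5) p. 46] [cite: DupuyHilado2025, §3.3, §3.4, §4.9, §4.12] [claim: Mochizuki2012, status: disputed] for every IUT sentence.
-/

noncomputable section

open Set Function NumberField IsDedekindDomain
open scoped Pointwise

namespace Summit.ABC.IUTFork.Cor312Prov

open Thm311 Thm311.Real Cor312 Cor312.Setting Cor312Vol Literature.IUT.LogThetaLattice Literature.IUT.LogVolume
  Literature.IUT.HodgeTheaters
open Literature.NumberTheory.NumberFields Literature.NumberTheory.GaloisRepresentations.Ultrametric

variable {F K Fbar : Type} [Field F] [NumberField F] [Field K] [NumberField K] [Algebra F K] [Field Fbar]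
  [Algebra F Fbar] [Algebra K Fbar] {E : WeierstrassCurve F} [E.IsElliptic] {l : ℕ} {Pb : BadPlacePredicates K}
  (D : InitialThetaData F K Fbar E l Pb) {logv : PadicLogs K} (hlog : LogvAnalytic logv)
  (M : Type) [Field M] [NumberField M]
  (archPk : ∀ (j : (thetaIndex (pilotDataOfK D K)).Label) (vQ : (thetaIndex (pilotDataOfK D K)).VQ),
    Set ((logShellsDH (pilotDataOfK D K) logv).Packet j vQ))
  (archSub : ∀ (j : (thetaIndex (pilotDataOfK D K)).Label) (v : (thetaIndex (pilotDataOfK D K)).V),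
    Set ((logShellsDH (pilotDataOfK D K) logv).Packet j ((thetaIndex (pilotDataOfK D K)).over v)))
  (Ψ : ℤ → ∀ v : (thetaIndex (pilotDataOfK D K)).V, v ∈ (thetaIndex (pilotDataOfK D K)).Vbad →
    Set ((logShellsDH (pilotDataOfK D K) logv).StarPacket v))
  (act : ℤ → ∀ v : (thetaIndex (pilotDataOfK D K)).V, v ∈ (thetaIndex (pilotDataOfK D K)).Vbad →
    (logShellsDH (pilotDataOfK D K) logv).StarPacket v → Module.End ℚ ((logShellsDH (pilotDataOfK D K) logv).StarPacket v))
  (Mmod : ℤ → ∀ j : (thetaIndex (pilotDataOfK D K)).LabelStar, Set ((logShellsDH (pilotDataOfK D K) logv).GlobalPacket j.1))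
  (region : ℤ → ∀ j : (thetaIndex (pilotDataOfK D K)).LabelStar, FinDivisor M → ∀ vQ : (thetaIndex (pilotDataOfK D K)).VQ,
    Set ((logShellsDH (pilotDataOfK D K) logv).Packet j.1 vQ))
  (n : ℤ) {HT : Type} {LogLink : HT → HT → Type} {IsFull : ∀ {s t : HT}, LogLink s t → Prop}
  (lat : LGPGaussianLogThetaLattice LogLink IsFull)
  {Frd : Type} {IsoF : Frd → Frd → Type} {Ob : Frd → Type} {realify : Frd → Frd} {Strip : Type}
  {IsoS : Strip → Strip → Type} {Mv : ∀ v : (thetaIndex (pilotDataOfK D K)).V, v ∈ (thetaIndex (pilotDataOfK D K)).Vbad → Type}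
  [∀ v h, Monoid (Mv v h)]
  (sig : GlobalLGPFrobenioidSignature (thetaIndex (pilotDataOfK D K)).lstar (thetaIndex (pilotDataOfK D K)).V
    (· ∈ (thetaIndex (pilotDataOfK D K)).Vbad) Frd IsoF Ob realify Strip IsoS Mv)
  (split : SplittingMonoids Mv) {ObΔ : Type} {N : ∀ v : (thetaIndex (pilotDataOfK D K)).V, v ∈ (thetaIndex (pilotDataOfK D K)).Vbad → Type}
  [∀ v h, Monoid (N v h)] (qData : QPilotData ObΔ N)
  (tq : ∀ (pp : Nat.Primes) (x : (thetaIndex (pilotDataOfK D K)).Fibre (.inr pp)),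
    haveI : Fact (pp : ℕ).Prime := ⟨pp.2⟩; kOf (pilotDataOfK D K) pp.1 x)
  (t : ∀ (pp : Nat.Primes) (_ : Fin (pilotDataOfK D K).lstar) (x : (thetaIndex (pilotDataOfK D K)).Fibre (.inr pp)),
    haveI : Fact (pp : ℕ).Prime := ⟨pp.2⟩; kOf (pilotDataOfK D K) pp.1 x)
  (htq0 : ∀ pp x, tq pp x ≠ 0)
  (htq1 : ∀ (pp : Nat.Primes) (x : (thetaIndex (pilotDataOfK D K)).Fibre (.inr pp)),
    haveI : Fact (pp : ℕ).Prime := ⟨pp.2⟩; placeOf (pilotDataOfK D K) pp.1 x ∉ (pilotDataOfK D K).S → ‖tq pp x‖ = 1)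
  (col : ℤ → Column (logShellsDH (pilotDataOfK D K) logv))
  (ht0 : ∀ pp i x, t pp i x ≠ 0)
  (ht : ∀ (pp : Nat.Primes) (i : Fin (pilotDataOfK D K).lstar) (x : (thetaIndex (pilotDataOfK D K)).Fibre (.inr pp)),
    haveI : Fact (pp : ℕ).Prime := ⟨pp.2⟩
    Real.log ‖t pp i x‖ = -((pilotDataOfK D K).thetaPilot i (placeOf (pilotDataOfK D K) pp.1 x)) *
      logNorm K (placeOf (pilotDataOfK D K) pp.1 x) / localDegree K (placeOf (pilotDataOfK D K) pp.1 x))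
  (htq : ∀ (pp : Nat.Primes) (x : (thetaIndex (pilotDataOfK D K)).Fibre (.inr pp)),
    haveI : Fact (pp : ℕ).Prime := ⟨pp.2⟩
    Real.log ‖tq pp x‖ = -((pilotDataOfK D K).qPilot (placeOf (pilotDataOfK D K) pp.1 x)) *
      logNorm K (placeOf (pilotDataOfK D K) pp.1 x) / localDegree K (placeOf (pilotDataOfK D K) pp.1 x))


/-- **The q-degree at a bad place from the pole order of a RATIONAL `j`-invariant**: if `j(E) = j₀ ∈ ℚ`, `x | p` is bad with
`e(K_x/ℚ_p) = e_p` and `ord_u(j₀) = −h` at the place `u` of `ℚ` under `x`, then `P_q(x) = e_p·h/(2l)` (as a real number). The CHOSEN realising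
q-idele has `‖t_q(x)‖ = p^{ord_u(j₀)/(2l)}` (abc-iut-w4-d026) and `= p^{−P_q(x)/e(x|p)}` (abc-iut-w5-d236). [cite: DupuyHilado2025, §3.3, §3.4]
[cite: Mochizuki2012, IUTchI Ex. 3.2 (iv) p. 71] -/
theorem qPilot_pilotDataOfK_eq_of_ord_rat (j₀ : ℚ) (hj : E.j = (j₀ : F)) (pp : Nat.Primes)
    (x : (thetaIndex (pilotDataOfK D K)).Fibre (.inr pp))
    (hx : haveI : Fact (pp : ℕ).Prime := ⟨pp.2⟩; placeOf (pilotDataOfK D K) pp.1 x ∈ (pilotDataOfK D K).S) {eₚ h : ℕ}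
    (he : haveI : Fact (pp : ℕ).Prime := ⟨pp.2⟩; absRamificationIdx (pp : ℕ) (kOf (pilotDataOfK D K) pp.1 x) = eₚ)
    (hord : haveI : Fact (pp : ℕ).Prime := ⟨pp.2⟩; ord ℚ (finBelow ℚ K (placeOf (pilotDataOfK D K) pp.1 x)) j₀ = -(h : ℤ)) :
    haveI : Fact (pp : ℕ).Prime := ⟨pp.2⟩
    (pilotDataOfK D K).qPilot (placeOf (pilotDataOfK D K) pp.1 x) = (eₚ : ℝ) * h / (2 * l) := by
  haveI : Fact (pp : ℕ).Prime := ⟨pp.2⟩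
  set w := placeOf (pilotDataOfK D K) pp.1 x with hw
  have hp1 : (1 : ℝ) < ((pp : ℕ) : ℝ) := by exact_mod_cast pp.2.one_lt
  have h1 := norm_chosenQIdele_eq_rpow_ord_rat' D pp x hx j₀ hj
  have h2 := norm_qIdele_eq_rpow_of_realises (pilotDataOfK D K) (exists_realising_qIdeles_pilotDataOfK D).choose
    (exists_realising_qIdeles_pilotDataOfK D).choose_spec.1 (exists_realising_qIdeles_pilotDataOfK D).choose_spec.2.2 pp x
  rw [h2] at h1
  have hexp : -((pilotDataOfK D K).qPilot w) / (ramIdx K w : ℝ) = (ord ℚ (finBelow ℚ K w) j₀ : ℝ) / (2 * l) := by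
    rcases lt_trichotomy (-((pilotDataOfK D K).qPilot w) / (ramIdx K w : ℝ)) ((ord ℚ (finBelow ℚ K w) j₀ : ℝ) / (2 * l)) with hlt | heq | hgt
    · exact absurd h1 (ne_of_lt ((Real.rpow_lt_rpow_left_iff hp1).mpr hlt))
    · exact heq
    · exact absurd h1 (ne_of_gt ((Real.rpow_lt_rpow_left_iff hp1).mpr hgt))
  have hram : (ramIdx K w : ℝ) = eₚ := by
    rw [ramIdx_eq K w, ← absRamificationIdx_rescaledCompletion K (pp : ℕ) w (natCast_mem_placeOf (pilotDataOfK D K) pp.1 x)]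
    exact_mod_cast he
  have he0 : (0 : ℝ) < eₚ := by
    have := absRamificationIdx_pos (pp : ℕ) (kOf (pilotDataOfK D K) pp.1 x)
    rw [he] at this
    exact_mod_cast this
  have hl0 : (0 : ℝ) < l := by exact_mod_cast lt_of_lt_of_le (by norm_num) D.five_le_l
  rw [hram, hord] at hexp
  push_cast at hexp
  field_simp at hexp
  field_simp
  linarith

include ht0 ht htq in
/-- **THE HULL LICENCE INHABITED AT A GENUINE `K`-LEVEL DATUM WITH RATIONAL `j`-INVARIANT, FROM PER-BAD-PRIME INTEGERS.** `X := pilotDataOfK D K`,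
`j(E) = j₀ ∈ ℚ`; Θ- and q-ideles realising the pilot divisors of `X`; per prime integers `e_p, D_p, h_p ∈ ℕ`, `ρin_p, ρout_p ∈ ℤ`. IF at every
BAD fibre point `x | p`: `e(K_x/ℚ_p) = e_p`, `D_p/e_p ≤ d(K_x)`, some `z ∉ log_p(𝒪^×_{K_x})` has `‖z‖ ≤ p^{−(ρin_p−1)/e_p}`, some
`z' ∈ log_p(𝒪^×_{K_x})` has `‖z'‖ ≥ p^{−ρout_p/e_p}`, and `ord_p(j₀) = −h_p` with `2l ∣ e_p·h_p`; the bad completions over `p` are pairwise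
`ℚ_p`-isomorphic; and with `P_p := e_p·h_p/(2l)` the integer cell `e_p·⌊(j²P_p − jD_p − (j+1)ρin_p)/e_p⌋ + (j+1)ρout_p ≤ P_p` holds at every
label `j = i+1 ≤ l⋆` — THEN abc-iut-c312-1's `Thm311ToCor312.Licence` holds at abc-iut-c312-7's `settingPrVolSharp X …`.
[cite: Mochizuki2012, IUTchI Ex. 3.2 (iv) p. 71; IUTchIII Cor. 3.12 Step (xi-f) p. 184; IUTchIV Prop. 1.1 p. 9] [cite: DupuyHilado2025, §3.3, §3.4, §4.9, §4.12]
[claim: Mochizuki2012, status: disputed] -/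
theorem licence_settingPrVolSharp_pilotDataOfK_of_orders_rat (j₀ : ℚ) (hj : E.j = (j₀ : F))
    (e Dd h : Nat.Primes → ℕ) (ρin ρout : Nat.Primes → ℤ)
    (hloc : ∀ (pp : Nat.Primes) (x : (thetaIndex (pilotDataOfK D K)).Fibre (.inr pp)),
      haveI : Fact (pp : ℕ).Prime := ⟨pp.2⟩
      placeOf (pilotDataOfK D K) pp.1 x ∈ (pilotDataOfK D K).S →
        absRamificationIdx (pp : ℕ) (kOf (pilotDataOfK D K) pp.1 x) = e pp ∧
        (Dd pp : ℝ) / (e pp : ℝ) ≤ differentOrd (pp : ℕ) (kOf (pilotDataOfK D K) pp.1 x) ∧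
        (∃ z : kOf (pilotDataOfK D K) pp.1 x, z ∉ logUnits (kOf (pilotDataOfK D K) pp.1 x) ∧
          ‖z‖ ≤ ((pp : ℕ) : ℝ) ^ (-(((ρin pp : ℝ) - 1) / (e pp : ℝ)))) ∧
        (∃ z ∈ logUnits (kOf (pilotDataOfK D K) pp.1 x), ((pp : ℕ) : ℝ) ^ (-((ρout pp : ℝ) / (e pp : ℝ))) ≤ ‖z‖) ∧
        ord ℚ (finBelow ℚ K (placeOf (pilotDataOfK D K) pp.1 x)) j₀ = -(h pp : ℤ) ∧ 2 * l ∣ e pp * h pp)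
    (hiso : ∀ (pp : Nat.Primes) (x y : (thetaIndex (pilotDataOfK D K)).Fibre (.inr pp)),
      haveI : Fact (pp : ℕ).Prime := ⟨pp.2⟩
      placeOf (pilotDataOfK D K) pp.1 x ∈ (pilotDataOfK D K).S → placeOf (pilotDataOfK D K) pp.1 y ∈ (pilotDataOfK D K).S →
        Nonempty (kOf (pilotDataOfK D K) pp.1 x ≃ₐ[ℚ_[pp]] kOf (pilotDataOfK D K) pp.1 y))
    (hcell : ∀ (pp : Nat.Primes), (haveI : Fact (pp : ℕ).Prime := ⟨pp.2⟩
        ∃ x : (thetaIndex (pilotDataOfK D K)).Fibre (.inr pp), placeOf (pilotDataOfK D K) pp.1 x ∈ (pilotDataOfK D K).S) →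
      ∀ i : Fin (pilotDataOfK D K).lstar,
        (e pp : ℤ) * (((((i : ℕ) + 1 : ℕ) : ℤ) ^ 2 * ((e pp * h pp / (2 * l) : ℕ) : ℤ) - (((i : ℕ) + 1 : ℕ) : ℤ) * (Dd pp : ℤ) -
            (((i : ℕ) + 2 : ℕ) : ℤ) * ρin pp) / (e pp : ℤ)) + (((i : ℕ) + 2 : ℕ) : ℤ) * ρout pp ≤ ((e pp * h pp / (2 * l) : ℕ) : ℤ)) :
    Thm311ToCor312.Licence
      (settingPrVolSharp (pilotDataOfK D K) hlog M archPk archSub Ψ act Mmod region n lat sig split qData tq t htq0 htq1) := by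
  refine licence_settingPrVolSharp_of_orders_of_realises (pilotDataOfK D K) hlog M archPk archSub Ψ act Mmod region n lat sig split qData
    tq t htq0 htq1 ht0 ht htq e Dd (fun pp => e pp * h pp / (2 * l)) ρin ρout (fun pp x hx => ?_) hiso hcell
  haveI : Fact (pp : ℕ).Prime := ⟨pp.2⟩
  obtain ⟨he, hD, hin, hout, hord, hdvd⟩ := hloc pp x hx
  refine ⟨he, hD, ?_, hin, hout⟩
  rw [qPilot_pilotDataOfK_eq_of_ord_rat D j₀ hj pp x hx he hord]
  have hl0 : (2 * l : ℝ) ≠ 0 := by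
    have : 0 < l := lt_of_lt_of_le (by norm_num) D.five_le_l
    positivity
  rw [Nat.cast_div hdvd (by exact_mod_cast hl0)]
  push_cast
  ring

include ht0 ht htq in
/-- **BRANCH C's PER-DATUM ANTECEDENT INHABITED at a genuine `K`-level datum with rational `j`-invariant** (any columns `col`; hypotheses of
`licence_settingPrVolSharp_pilotDataOfK_of_orders_rat`): «∃ ρ qK, QPinned ∧ PilotKummerCompatHull» at `settingPrVolSharp (pilotDataOfK D K) …` —
the per-datum instance of the window certificates' `hSHw`-shaped binder HOLDS. [cite: Mochizuki2012, IUTchIII Cor. 3.12 Step (xi-d) p. 183, (xi-f) p. 184]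
[cite: DupuyHilado2025, §3.3, §3.4, §4.9] [claim: Mochizuki2012, status: disputed] -/
theorem exists_qPinned_and_hull_settingPrVolSharp_pilotDataOfK_of_orders_rat (j₀ : ℚ) (hj : E.j = (j₀ : F))
    (e Dd h : Nat.Primes → ℕ) (ρin ρout : Nat.Primes → ℤ)
    (hloc : ∀ (pp : Nat.Primes) (x : (thetaIndex (pilotDataOfK D K)).Fibre (.inr pp)),
      haveI : Fact (pp : ℕ).Prime := ⟨pp.2⟩
      placeOf (pilotDataOfK D K) pp.1 x ∈ (pilotDataOfK D K).S →
        absRamificationIdx (pp : ℕ) (kOf (pilotDataOfK D K) pp.1 x) = e pp ∧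
        (Dd pp : ℝ) / (e pp : ℝ) ≤ differentOrd (pp : ℕ) (kOf (pilotDataOfK D K) pp.1 x) ∧
        (∃ z : kOf (pilotDataOfK D K) pp.1 x, z ∉ logUnits (kOf (pilotDataOfK D K) pp.1 x) ∧
          ‖z‖ ≤ ((pp : ℕ) : ℝ) ^ (-(((ρin pp : ℝ) - 1) / (e pp : ℝ)))) ∧
        (∃ z ∈ logUnits (kOf (pilotDataOfK D K) pp.1 x), ((pp : ℕ) : ℝ) ^ (-((ρout pp : ℝ) / (e pp : ℝ))) ≤ ‖z‖) ∧
        ord ℚ (finBelow ℚ K (placeOf (pilotDataOfK D K) pp.1 x)) j₀ = -(h pp : ℤ) ∧ 2 * l ∣ e pp * h pp)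
    (hiso : ∀ (pp : Nat.Primes) (x y : (thetaIndex (pilotDataOfK D K)).Fibre (.inr pp)),
      haveI : Fact (pp : ℕ).Prime := ⟨pp.2⟩
      placeOf (pilotDataOfK D K) pp.1 x ∈ (pilotDataOfK D K).S → placeOf (pilotDataOfK D K) pp.1 y ∈ (pilotDataOfK D K).S →
        Nonempty (kOf (pilotDataOfK D K) pp.1 x ≃ₐ[ℚ_[pp]] kOf (pilotDataOfK D K) pp.1 y))
    (hcell : ∀ (pp : Nat.Primes), (haveI : Fact (pp : ℕ).Prime := ⟨pp.2⟩
        ∃ x : (thetaIndex (pilotDataOfK D K)).Fibre (.inr pp), placeOf (pilotDataOfK D K) pp.1 x ∈ (pilotDataOfK D K).S) →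
      ∀ i : Fin (pilotDataOfK D K).lstar,
        (e pp : ℤ) * (((((i : ℕ) + 1 : ℕ) : ℤ) ^ 2 * ((e pp * h pp / (2 * l) : ℕ) : ℤ) - (((i : ℕ) + 1 : ℕ) : ℤ) * (Dd pp : ℤ) -
            (((i : ℕ) + 2 : ℕ) : ℤ) * ρin pp) / (e pp : ℤ)) + (((i : ℕ) + 2 : ℕ) : ℤ) * ρout pp ≤ ((e pp * h pp / (2 * l) : ℕ) : ℤ)) :
    ∃ (ρ' : (∀ v : (thetaIndex (pilotDataOfK D K)).V, v ∈ (thetaIndex (pilotDataOfK D K)).Vbad →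
            Set ((logShellsDH (pilotDataOfK D K) logv).StarPacket v)) →
          ∀ (j : (thetaIndex (pilotDataOfK D K)).Label) (vQ : (thetaIndex (pilotDataOfK D K)).VQ),
            Set ((logShellsDH (pilotDataOfK D K) logv).Packet j vQ))
        (qK : ∀ v : (thetaIndex (pilotDataOfK D K)).V, v ∈ (thetaIndex (pilotDataOfK D K)).Vbad →
          Set ((logShellsDH (pilotDataOfK D K) logv).StarPacket v)),
        QPinned ({ toSituation := situationPrVol (pilotDataOfK D K) hlog M archPk archSub Ψ act Mmod region, col := col } :
            LatticeSituation (thetaIndex (pilotDataOfK D K)))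
          (settingPrVolSharp (pilotDataOfK D K) hlog M archPk archSub Ψ act Mmod region n lat sig split qData tq t htq0 htq1) ρ' qK ∧
        PilotKummerCompatHull ({ toSituation := situationPrVol (pilotDataOfK D K) hlog M archPk archSub Ψ act Mmod region, col := col } :
            LatticeSituation (thetaIndex (pilotDataOfK D K)))
          (settingPrVolSharp (pilotDataOfK D K) hlog M archPk archSub Ψ act Mmod region n lat sig split qData tq t htq0 htq1) ρ' qK :=
  (exists_qPinned_and_hull_settingPrVolSharp_iff_licence (pilotDataOfK D K) hlog M archPk archSub Ψ act Mmod region n lat sig split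
    qData tq t htq0 htq1 col (fun pp x => norm_qIdele_le_one_of_realises (pilotDataOfK D K) tq htq0 htq pp x)).2
    (licence_settingPrVolSharp_pilotDataOfK_of_orders_rat D hlog M archPk archSub Ψ act Mmod region n lat sig split qData tq t htq0 htq1
      ht0 ht htq j₀ hj e Dd h ρin ρout hloc hiso hcell)

end Summit.ABC.IUTFork.Cor312Prov

end
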